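import Summits.QuantumFields.YangMills.Theorems.BalabanLadderIRAfOnsetPlaquetteMoments
import Summits.QuantumFields.YangMills.Theorems.TunedSequenceExists.Negative.Freezing
import Literature.MathematicalPhysics.QuantumFieldTheory.ActionDensityTimeReflection

/-!
# Crux `IR` (stmt-QuantumFields-19354), line `af-pincer`, stub `stub_afOnsetUc : AFToOnsetUKPc` (X-side):
# volume-uniform covariance bound for the action density at weak coupling (lattice-scale asymptotic freedom, part 2/3)

Sequel of `Theorems/BalabanLadderIRAfOnsetPlaquetteMoments` (seat ym-19354-afpincer-s2).

* `dens_torusLift_eq` — dictionary: the action density of the periodic lift at `x` is `Σ_q (N − φ_{(x̄, q)})` over the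
  six orientations (`x̄ = x mod side`; tree `plaquetteHolonomyZd_torusLift'`, `actionDensity_eq_sum_subtype`).
* `integral_const_sub_mul_const_sub` — `Cov(c − X, c − Y) = Cov(X, Y)` in a probability state.
* **`exists_abs_torusCov_dens_le`** — for a lattice representation `r`:
  `|Cov_{β,2L+1}(A_x, A_y)| ≤ W (1 + log β)²/β²` for ALL sites `x, y`, all odd tori `2L+1 ≥ 3`, all `β ≥ 1`
  (`|Cov(Φ_x, Φ_y)| ≤ ⟨Φ_xΦ_y⟩ + ⟨Φ_x⟩⟨Φ_y⟩ ≤ ½(⟨Φ_x²⟩ + ⟨Φ_y²⟩) + ⟨Φ_x⟩⟨Φ_y⟩`, Cauchy–Schwarz over the six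
  orientations, and the moments of part 1).

HONEST FRAMING.  No decay in `|x − y|` is proved or claimed (that would be UV-engine content); the bound only says the bare
action density has `O(log β/β)` fluctuations uniformly in the volume.  One open stub of a CONDITIONAL chain; not a gap claim.
-/

set_option autoImplicit false

noncomputable section

open MeasureTheory Filter Topology Finset
open scoped BigOperators SchwartzMap
open Literature.MathematicalPhysics.QuantumFieldTheory hiding ZdEdge
open Literature.MathematicalPhysics.QuantumLattice
open Literature.Probability.LatticeModels (Site box mem_box)
open Summit.QuantumFields.YangMills.Cruxes.OSLegsFromFemtoAndGap.DlrCollarTransfer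
open Summit.QuantumFields.YangMills.Theorems.OSLegsFromFemtoAndGap (sum_decay_le summable_inv_succ_sq
  mul_norm_le_norm_smul_siteToE)
open Literature.MathematicalPhysics.QuantumFieldTheory.WilsonRP (plaqRe abs_plaqRe_le measurable_plaqRe)
open Summit.QuantumFields.YangMills.Theorems.TunedSequenceExists.Negative.Freezing (plaquetteHolonomyZd_torusLift'
  plaquetteHolonomyZd_configShift)

namespace Summit.QuantumFields.YangMills.Cruxes.IR.AfOnset

/-! ## The action density of the periodic lift; volume-uniform covariance bound at weak coupling -/
section Covariance

variable {G : Type} [Group G] [TopologicalSpace G] [IsTopologicalGroup G] [CompactSpace G]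
  [MeasurableSpace G] [BorelSpace G] (r : LatticeRep G)

/-- **Dictionary**: the action density of the periodic lift at the site `x` is the sum over the six orientations `q`
of `N − φ_{(x̄, q)}`, `x̄ = x mod (side)`, `φ` the torus plaquette cost. [folklore] -/
theorem dens_torusLift_eq (S : ℕ) (x : Site 4) (U : GaugeConfig 4 S G) :
    dens G r x (torusLift S U) =
      ∑ q : {q : Fin 4 × Fin 4 // q.1 < q.2},
        ((r.N : ℝ) - plaquetteCost r.ρ U (Literature.Probability.LatticeModels.Torus.proj S x, q)) := by
  show r.curvature.F (configShift (-x) (torusLift S U)) = _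
  rw [show r.curvature.F = actionDensity r.ρ from rfl, actionDensity_eq_sum_subtype]
  refine Finset.sum_congr rfl fun q _ => ?_
  unfold plaquetteObs plaquetteCost
  rw [plaquetteHolonomyZd_configShift, sub_neg_eq_add, zero_add, plaquetteHolonomyZd_torusLift']
  ring

/-- Covariance of affine images: `Cov(c − X, c − Y) = Cov(X, Y)` in a probability state. [folklore] -/
theorem integral_const_sub_mul_const_sub {Ω : Type*} [MeasurableSpace Ω] (μ : Measure Ω) [IsProbabilityMeasure μ]
    {X Y : Ω → ℝ} (hX : Integrable X μ) (hY : Integrable Y μ) (hXY : Integrable (fun ω => X ω * Y ω) μ) (c : ℝ) :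
    (∫ ω, (c - X ω) * (c - Y ω) ∂μ) - (∫ ω, (c - X ω) ∂μ) * (∫ ω, (c - Y ω) ∂μ) =
      (∫ ω, X ω * Y ω ∂μ) - (∫ ω, X ω ∂μ) * (∫ ω, Y ω ∂μ) := by
  have i1 : ∫ ω, (c - X ω) ∂μ = c - ∫ ω, X ω ∂μ := by
    rw [integral_sub (integrable_const c) hX, integral_const]; simp
  have i2 : ∫ ω, (c - Y ω) ∂μ = c - ∫ ω, Y ω ∂μ := by
    rw [integral_sub (integrable_const c) hY, integral_const]; simp
  have e : (fun ω => (c - X ω) * (c - Y ω)) = fun ω => ((c * c - c * Y ω) - c * X ω) + X ω * Y ω := by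
    funext ω; ring
  have iA : Integrable (fun ω => c * c - c * Y ω) μ := (integrable_const _).sub (hY.const_mul c)
  have iB : Integrable (fun ω => (c * c - c * Y ω) - c * X ω) μ := iA.sub (hX.const_mul c)
  have iX : ∫ ω, c * X ω ∂μ = c * ∫ ω, X ω ∂μ := integral_const_mul c X
  have iY : ∫ ω, c * Y ω ∂μ = c * ∫ ω, Y ω ∂μ := integral_const_mul c Y
  have i3 : ∫ ω, (c - X ω) * (c - Y ω) ∂μ =
      c * c - c * (∫ ω, Y ω ∂μ) - c * (∫ ω, X ω ∂μ) + ∫ ω, X ω * Y ω ∂μ := by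
    rw [e, integral_add iB hXY, integral_sub iA (hX.const_mul c), integral_sub (integrable_const _) (hY.const_mul c),
      iX, iY, integral_const]
    simp
  rw [i1, i2, i3]
  ring

/-- **Volume-uniform covariance bound at weak coupling.**  For a lattice representation `r` there is `W ≥ 0` with
`|Cov_{β, 2L+1}(A_x, A_y)| ≤ W (1 + log β)²/β²` for all sites `x, y ∈ ℤ⁴`, every odd torus `2L+1 ≥ 3` and every
`β ≥ 1` (`A` the action density; `Cov(A_x, A_y) = Cov(Φ_x, Φ_y)` with `Φ_x = Σ_q φ_{(x̄,q)} ≥ 0`,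
`|Cov| ≤ ⟨Φ_xΦ_y⟩ + ⟨Φ_x⟩⟨Φ_y⟩ ≤ ½(⟨Φ_x²⟩ + ⟨Φ_y²⟩) + ⟨Φ_x⟩⟨Φ_y⟩` and §2).  No decay in `|x − y|` is claimed. [folklore] -/
theorem exists_abs_torusCov_dens_le :
    ∃ W : ℝ, 0 ≤ W ∧ ∀ (L : ℕ), 1 ≤ L → ∀ β : ℝ, 1 ≤ β → ∀ x y : Site 4,
      |torusE G r β L (fun U => dens G r x U * dens G r y U) -
          torusE G r β L (dens G r x) * torusE G r β L (dens G r y)| ≤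
        W * (1 + Real.log β) ^ 2 / β ^ 2 := by
  haveI : SecondCountableTopology G :=
    (r.continuous.isClosedEmbedding r.injective).isEmbedding.secondCountableTopology
  obtain ⟨K, hK0, hK⟩ := exists_plaquetteCost_moments_le r
  obtain ⟨m, hmdef⟩ : ∃ m : ℝ, m = (Fintype.card {q : Fin 4 × Fin 4 // q.1 < q.2} : ℝ) := ⟨_, rfl⟩
  have hm0 : 0 ≤ m := by rw [hmdef]; exact Nat.cast_nonneg _
  obtain ⟨N, hNdef⟩ : ∃ N : ℝ, N = (r.N : ℝ) := ⟨_, rfl⟩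
  have hN0 : 0 ≤ N := by rw [hNdef]; exact Nat.cast_nonneg _
  refine ⟨m ^ 2 * K + (m * K) ^ 2, by positivity, fun L hL β hβ x y => ?_⟩
  have hβ0 : 0 < β := lt_of_lt_of_le one_pos hβ
  haveI := isProbabilityMeasure_wilsonMeasure (d := 4) (L := 2 * L + 1) r.ρ r.continuous β
  obtain ⟨ℓ, hℓ⟩ : ∃ ℓ : ℝ, ℓ = 1 + Real.log β := ⟨_, rfl⟩
  have hℓ0 : 0 ≤ ℓ := by have := Real.log_nonneg hβ; rw [hℓ]; linarith
  -- per-plaquette facts: measurable, values in `[0, 2N]`, moments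
  have hq : ∀ q : Plaquette 4 (2 * L + 1),
      Measurable (fun U : GaugeConfig 4 (2 * L + 1) G => plaquetteCost r.ρ U q) ∧
      (∀ U, 0 ≤ plaquetteCost r.ρ U q ∧ plaquetteCost r.ρ U q ≤ 2 * N) := by
    intro q
    refine ⟨measurable_const.sub (measurable_plaqRe r.ρ r.continuous q), fun U => ?_⟩
    have h := abs_le.1 (abs_plaqRe_le r.ρ r.continuous U q)
    change 0 ≤ (r.N : ℝ) - plaqRe r.ρ U q ∧ (r.N : ℝ) - plaqRe r.ρ U q ≤ 2 * N
    rw [← hNdef] at h ⊢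
    constructor <;> linarith [h.1, h.2]
  have hqint : ∀ q : Plaquette 4 (2 * L + 1),
      Integrable (fun U : GaugeConfig 4 (2 * L + 1) G => plaquetteCost r.ρ U q)
        (wilsonMeasure (d := 4) (L := 2 * L + 1) r.ρ β) := fun q =>
    integrable_of_bound (hq q).1.aestronglyMeasurable (C := 2 * N) fun U => by
      rw [abs_of_nonneg ((hq q).2 U).1]; exact ((hq q).2 U).2
  have hq2int : ∀ q : Plaquette 4 (2 * L + 1),
      Integrable (fun U : GaugeConfig 4 (2 * L + 1) G => plaquetteCost r.ρ U q ^ 2)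
        (wilsonMeasure (d := 4) (L := 2 * L + 1) r.ρ β) := fun q =>
    integrable_of_bound ((hq q).1.pow_const 2).aestronglyMeasurable (C := (2 * N) ^ 2) fun U => by
      rw [abs_of_nonneg (sq_nonneg _)]; exact pow_le_pow_left₀ ((hq q).2 U).1 ((hq q).2 U).2 2
  have hmom1 : ∀ q : Plaquette 4 (2 * L + 1),
      ∫ U, plaquetteCost r.ρ U q ∂(wilsonMeasure (d := 4) (L := 2 * L + 1) r.ρ β) ≤ K * ℓ / β := by
    intro q; rw [hℓ]; exact (hK L hL β hβ q).1
  have hmom2 : ∀ q : Plaquette 4 (2 * L + 1),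
      ∫ U, plaquetteCost r.ρ U q ^ 2 ∂(wilsonMeasure (d := 4) (L := 2 * L + 1) r.ρ β) ≤ K * ℓ ^ 2 / β ^ 2 := by
    intro q; rw [hℓ]; exact (hK L hL β hβ q).2
  -- the plaquette sums `Φ_z` (kept opaque) and the constant `c`
  obtain ⟨Φ, hΦ⟩ : ∃ Φ : Site 4 → GaugeConfig 4 (2 * L + 1) G → ℝ, ∀ z, Φ z = fun U =>
      ∑ q : {q : Fin 4 × Fin 4 // q.1 < q.2},
        plaquetteCost r.ρ U (Literature.Probability.LatticeModels.Torus.proj (2 * L + 1) z, q) :=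
    ⟨_, fun _ => rfl⟩
  obtain ⟨c, hc⟩ : ∃ c : ℝ, c = ∑ _q : {q : Fin 4 × Fin 4 // q.1 < q.2}, N := ⟨_, rfl⟩
  have hdens : ∀ (z : Site 4) (U : GaugeConfig 4 (2 * L + 1) G),
      dens G r z (torusLift (2 * L + 1) U) = c - Φ z U := by
    intro z U
    rw [dens_torusLift_eq, Finset.sum_sub_distrib, hΦ z, hc, hNdef]
  -- per-site facts
  have hΦm : ∀ z, Measurable (Φ z) := fun z => by
    rw [hΦ z]; exact Finset.measurable_sum _ fun q _ => (hq _).1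
  have hΦ0 : ∀ z U, 0 ≤ Φ z U := fun z U => by
    rw [hΦ z]; exact Finset.sum_nonneg fun q _ => ((hq _).2 U).1
  have hΦB : ∀ z U, Φ z U ≤ m * (2 * N) := by
    intro z U
    rw [hΦ z]
    calc ∑ q : {q : Fin 4 × Fin 4 // q.1 < q.2},
          plaquetteCost r.ρ U (Literature.Probability.LatticeModels.Torus.proj (2 * L + 1) z, q)
        ≤ ∑ _q : {q : Fin 4 × Fin 4 // q.1 < q.2}, 2 * N := Finset.sum_le_sum fun q _ => ((hq _).2 U).2
      _ = m * (2 * N) := by rw [Finset.sum_const, nsmul_eq_mul, Finset.card_univ, hmdef]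
  have hΦint : ∀ z, Integrable (Φ z) (wilsonMeasure (d := 4) (L := 2 * L + 1) r.ρ β) := fun z =>
    integrable_of_bound (hΦm z).aestronglyMeasurable (C := m * (2 * N)) fun U => by
      rw [abs_of_nonneg (hΦ0 z U)]; exact hΦB z U
  have hΦ2int : ∀ z, Integrable (fun U => Φ z U ^ 2) (wilsonMeasure (d := 4) (L := 2 * L + 1) r.ρ β) := fun z =>
    integrable_of_bound ((hΦm z).pow_const 2).aestronglyMeasurable (C := (m * (2 * N)) ^ 2) fun U => by
      rw [abs_of_nonneg (sq_nonneg _)]; exact pow_le_pow_left₀ (hΦ0 z U) (hΦB z U) 2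
  have hΦΦint : Integrable (fun U => Φ x U * Φ y U) (wilsonMeasure (d := 4) (L := 2 * L + 1) r.ρ β) :=
    integrable_of_bound ((hΦm x).mul (hΦm y)).aestronglyMeasurable (C := (m * (2 * N)) * (m * (2 * N)))
      fun U => by
        rw [abs_mul, abs_of_nonneg (hΦ0 x U), abs_of_nonneg (hΦ0 y U)]
        exact mul_le_mul (hΦB x U) (hΦB y U) (hΦ0 y U) (by positivity)
  have hmean : ∀ z, ∫ U, Φ z U ∂(wilsonMeasure (d := 4) (L := 2 * L + 1) r.ρ β) ≤ m * (K * ℓ / β) := by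
    intro z
    rw [hΦ z, integral_finsetSum _ fun q _ => hqint _]
    calc ∑ q : {q : Fin 4 × Fin 4 // q.1 < q.2},
          ∫ U, plaquetteCost r.ρ U (Literature.Probability.LatticeModels.Torus.proj (2 * L + 1) z, q)
            ∂(wilsonMeasure (d := 4) (L := 2 * L + 1) r.ρ β)
        ≤ ∑ _q : {q : Fin 4 × Fin 4 // q.1 < q.2}, K * ℓ / β := Finset.sum_le_sum fun q _ => hmom1 _
      _ = m * (K * ℓ / β) := by rw [Finset.sum_const, nsmul_eq_mul, Finset.card_univ, hmdef]
  have hsq : ∀ z, ∫ U, Φ z U ^ 2 ∂(wilsonMeasure (d := 4) (L := 2 * L + 1) r.ρ β) ≤ m * (m * (K * ℓ ^ 2 / β ^ 2)) := by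
    intro z
    have hpt : ∀ U, Φ z U ^ 2 ≤ m * ∑ q : {q : Fin 4 × Fin 4 // q.1 < q.2},
        plaquetteCost r.ρ U (Literature.Probability.LatticeModels.Torus.proj (2 * L + 1) z, q) ^ 2 := by
      intro U
      have h := sq_sum_le_card_mul_sum_sq (s := (Finset.univ : Finset {q : Fin 4 × Fin 4 // q.1 < q.2}))
        (f := fun q => plaquetteCost r.ρ U (Literature.Probability.LatticeModels.Torus.proj (2 * L + 1) z, q))
      rw [Finset.card_univ, ← hmdef] at h
      rw [hΦ z]
      exact h
    have hint0 : Integrable (fun U => ∑ q : {q : Fin 4 × Fin 4 // q.1 < q.2},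
        plaquetteCost r.ρ U (Literature.Probability.LatticeModels.Torus.proj (2 * L + 1) z, q) ^ 2)
        (wilsonMeasure (d := 4) (L := 2 * L + 1) r.ρ β) :=
      integrable_finsetSum _ fun q _ => hq2int _
    calc ∫ U, Φ z U ^ 2 ∂(wilsonMeasure (d := 4) (L := 2 * L + 1) r.ρ β)
        ≤ ∫ U, m * ∑ q : {q : Fin 4 × Fin 4 // q.1 < q.2},
            plaquetteCost r.ρ U (Literature.Probability.LatticeModels.Torus.proj (2 * L + 1) z, q) ^ 2
              ∂(wilsonMeasure (d := 4) (L := 2 * L + 1) r.ρ β) :=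
          integral_mono (hΦ2int z) (hint0.const_mul m) hpt
      _ = m * ∑ q : {q : Fin 4 × Fin 4 // q.1 < q.2},
            ∫ U, plaquetteCost r.ρ U (Literature.Probability.LatticeModels.Torus.proj (2 * L + 1) z, q) ^ 2
              ∂(wilsonMeasure (d := 4) (L := 2 * L + 1) r.ρ β) := by
          rw [integral_const_mul, integral_finsetSum _ fun q _ => hq2int _]
      _ ≤ m * ∑ _q : {q : Fin 4 × Fin 4 // q.1 < q.2}, K * ℓ ^ 2 / β ^ 2 := by
          gcongr with q _
          exact hmom2 _
      _ = m * (m * (K * ℓ ^ 2 / β ^ 2)) := by rw [Finset.sum_const, nsmul_eq_mul, Finset.card_univ, hmdef]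
  -- the covariance identity and the bound
  have hcov : torusE G r β L (fun U => dens G r x U * dens G r y U) -
      torusE G r β L (dens G r x) * torusE G r β L (dens G r y) =
      (∫ U, Φ x U * Φ y U ∂(wilsonMeasure (d := 4) (L := 2 * L + 1) r.ρ β)) -
        (∫ U, Φ x U ∂(wilsonMeasure (d := 4) (L := 2 * L + 1) r.ρ β)) *
          (∫ U, Φ y U ∂(wilsonMeasure (d := 4) (L := 2 * L + 1) r.ρ β)) := by
    unfold torusE
    simp only [hdens]
    exact integral_const_sub_mul_const_sub _ (hΦint x) (hΦint y) hΦΦint c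
  rw [hcov]
  have hprodint : Integrable (fun U => (Φ x U ^ 2 + Φ y U ^ 2) / 2)
      (wilsonMeasure (d := 4) (L := 2 * L + 1) r.ρ β) := ((hΦ2int x).add (hΦ2int y)).div_const 2
  have hprod : ∫ U, Φ x U * Φ y U ∂(wilsonMeasure (d := 4) (L := 2 * L + 1) r.ρ β) ≤
      (∫ U, Φ x U ^ 2 ∂(wilsonMeasure (d := 4) (L := 2 * L + 1) r.ρ β) +
        ∫ U, Φ y U ^ 2 ∂(wilsonMeasure (d := 4) (L := 2 * L + 1) r.ρ β)) / 2 := by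
    have hpt : ∀ U, Φ x U * Φ y U ≤ (Φ x U ^ 2 + Φ y U ^ 2) / 2 := fun U => by
      linarith [two_mul_le_add_sq (Φ x U) (Φ y U)]
    calc ∫ U, Φ x U * Φ y U ∂(wilsonMeasure (d := 4) (L := 2 * L + 1) r.ρ β)
        ≤ ∫ U, (Φ x U ^ 2 + Φ y U ^ 2) / 2 ∂(wilsonMeasure (d := 4) (L := 2 * L + 1) r.ρ β) :=
          integral_mono hΦΦint hprodint hpt
      _ = (∫ U, Φ x U ^ 2 ∂(wilsonMeasure (d := 4) (L := 2 * L + 1) r.ρ β) +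
            ∫ U, Φ y U ^ 2 ∂(wilsonMeasure (d := 4) (L := 2 * L + 1) r.ρ β)) / 2 := by
          rw [integral_div, integral_add (hΦ2int x) (hΦ2int y)]
  have hE0 : ∀ z, 0 ≤ ∫ U, Φ z U ∂(wilsonMeasure (d := 4) (L := 2 * L + 1) r.ρ β) := fun z =>
    integral_nonneg fun U => hΦ0 z U
  have hP0 : 0 ≤ ∫ U, Φ x U * Φ y U ∂(wilsonMeasure (d := 4) (L := 2 * L + 1) r.ρ β) :=
    integral_nonneg fun U => mul_nonneg (hΦ0 x U) (hΦ0 y U)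
  rw [hℓ] at hmean hsq
  calc |(∫ U, Φ x U * Φ y U ∂(wilsonMeasure (d := 4) (L := 2 * L + 1) r.ρ β)) -
        (∫ U, Φ x U ∂(wilsonMeasure (d := 4) (L := 2 * L + 1) r.ρ β)) *
          (∫ U, Φ y U ∂(wilsonMeasure (d := 4) (L := 2 * L + 1) r.ρ β))|
      ≤ |∫ U, Φ x U * Φ y U ∂(wilsonMeasure (d := 4) (L := 2 * L + 1) r.ρ β)| +
          |(∫ U, Φ x U ∂(wilsonMeasure (d := 4) (L := 2 * L + 1) r.ρ β)) *
            (∫ U, Φ y U ∂(wilsonMeasure (d := 4) (L := 2 * L + 1) r.ρ β))| := abs_sub _ _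
    _ = (∫ U, Φ x U * Φ y U ∂(wilsonMeasure (d := 4) (L := 2 * L + 1) r.ρ β)) +
          (∫ U, Φ x U ∂(wilsonMeasure (d := 4) (L := 2 * L + 1) r.ρ β)) *
            (∫ U, Φ y U ∂(wilsonMeasure (d := 4) (L := 2 * L + 1) r.ρ β)) := by
        rw [abs_of_nonneg hP0, abs_of_nonneg (mul_nonneg (hE0 x) (hE0 y))]
    _ ≤ (m * (m * (K * (1 + Real.log β) ^ 2 / β ^ 2)) + m * (m * (K * (1 + Real.log β) ^ 2 / β ^ 2))) / 2 +
          (m * (K * (1 + Real.log β) / β)) * (m * (K * (1 + Real.log β) / β)) := by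
        have h1 := hprod.trans (div_le_div_of_nonneg_right (add_le_add (hsq x) (hsq y)) (by norm_num : (0:ℝ) ≤ 2))
        have hB0 : 0 ≤ m * (K * (1 + Real.log β) / β) := by
          have := Real.log_nonneg hβ
          positivity
        have h2 := mul_le_mul (hmean x) (hmean y) (hE0 y) hB0
        exact add_le_add h1 h2
    _ = (m ^ 2 * K + (m * K) ^ 2) * (1 + Real.log β) ^ 2 / β ^ 2 := by
        field_simp
        ring

end Covariance

end Summit.QuantumFields.YangMills.Cruxes.IR.AfOnset

end
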